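import Summits.NavierStokesRegularity.FluidComputer.DampedTransitionMisfire

/-!
# Tao's delay gate under NON-UNIFORM diagonal damping, part 10: INPUT FRAGILITY, II — PREMATURE firing on a
# clock-mode perturbation of size `+10ε`

Companion of `DampedTransition*.lean` (cell `pub-fluidc`, seat bp1). HONEST FRAMING (verbatim): low prior, high
value-of-information experiment on Tao's machine paradigm; NOT a claim that NS blows up. Five-mode truncation (5.5)
of [Tao2016AveragedNS, §5.5] with a diagonal damping `-E(t) * X`, `0 ≤ Eᵢ(t) ≤ η`; nothing about Navier–Stokes.

The other sign of part 9 (`DampedTransitionMisfire.lean`): if the input clock is `b(0) = β` with `10ε ≤ β ≤ 1/10`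
(input `(1, β, 0, 0, 0)`, any damping `η ≤ 1/4`, `M ≥ 1`, `Mε² ≤ 1`, `K ≥ 16`), the trigger reaches its critical
level `ε²K⁻¹⁰` at some time `t ≤ 1` (`prefire_of_positive_clock`; `prefire_family` under the family of the
gate theorem) — whereas THE DAMPED GATE THEOREM (`firingPhase`, part 7) has `c < ε²K⁻¹⁰` on `[0, t_c)`
with `t_c ≥ √2 - 24 log K/M - 20η > 1.39`. Mechanism (`prefire_aux`, one continuous induction up to the hitting time):
while `c ≤ ε²K⁻¹⁰` the rotor is off (`d² + ã² ≤ 4K⁻¹⁰t`), the clock stays in `[β/2, β + 2εt]`, the carrier keeps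
`a² ≥ 2/5`, so the seed gives `c ≥ (2/5)ε²e^{-M}t` and the amplifier (`ε⁻¹Mb ≥ 5M`) makes `c·e^{-4Mt}`
non-decreasing: `c(1) ≥ (1/5)ε²e^{M} > ε²K⁻¹⁰`. Together with part 9: the clock mode of a downstream gate must be
unexcited to accuracy `O(ε) ≤ e^{-10M}K⁻¹⁰⁰` in BOTH directions, far beyond the `O(K⁻¹⁰)` accuracy of an upstream
output. [cite: Tao2016AveragedNS, §5.5 (5.5), Theorem 5.3; §6.1]. No named facts; 0 sorry.
-/

noncomputable section

namespace Summit.NavierStokesRegularity.FluidComputer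

open Real Set Filter Topology
open Literature.Analysis.FluidPDE.Tao2016AveragedNS
open Literature.Analysis.FluidPDE.Tao2016AveragedNS.Thm53 (monotoneOn_intFactor antitoneOn_sub_of_deriv_le
  monotoneOn_sub_of_le_deriv)
open Literature.Analysis.FluidPDE.Tao2016AveragedNS.Thm53With (family_params eps_facts)

namespace DampedTransition

section Prefire

variable {K M ε η β : ℝ} {E X : ℝ → Fin 5 → ℝ}

/-- Bootstrap, I (clock and trigger sign). Input `(1, β, 0, 0, 0)`, `10ε ≤ β ≤ 1/10`, damping `η ≤ 1/4`,
`M ≥ 1`, `Mε² ≤ 1`, `K ≥ 16`; on `[0,τ]` (`τ ≤ 1`) assume `c ≤ ε²K⁻¹⁰`. Then on `[0,τ]`: `c ≥ 0` and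
`β/2 ≤ b ≤ β + 2εt`. [cite: Tao2016AveragedNS, §5.5 (5.5)] -/
theorem prefire_clock
    (hX : ∀ t ∈ Icc (0:ℝ) 2, HasDerivAt X (delayCircuitWith K M ε (X t) - E t * X t) t)
    (hE : ∀ t ∈ Icc (0:ℝ) 2, ∀ i, 0 ≤ E t i ∧ E t i ≤ η) (hη : η ≤ 1 / 4)
    (h00 : X 0 0 = 1) (h01 : X 0 1 = β) (h02 : X 0 2 = 0) (h03 : X 0 3 = 0) (h04 : X 0 4 = 0)
    (hβε : 10 * ε ≤ β) (hβ : β ≤ 1 / 10) (hε : 0 < ε) (hM1 : 1 ≤ M) (hMε : M * ε ^ 2 ≤ 1) (hK : 16 ≤ K)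
    {τ : ℝ} (hτ1 : τ ≤ 1) (hcθ : ∀ t ∈ Icc 0 τ, X t 2 ≤ ε ^ 2 / K ^ 10) :
    ∀ s ∈ Icc 0 τ, 0 ≤ X s 2 ∧ β / 2 ≤ X s 1 ∧ X s 1 ≤ β + 2 * ε * s := by
  have hI : ∀ s ∈ Icc 0 τ, s ∈ Icc (0:ℝ) 2 := fun s hs => ⟨hs.1, by linarith [hs.2]⟩
  have hK0 : 0 < K := by linarith
  have hβ0 : 0 < β := by linarith
  have hEn0 : energy (X 0) = 1 + β ^ 2 := by
    simp only [energy, Fin.sum_univ_five, h00, h01, h02, h03, h04]; ring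
  have hEn2 : energy (X 0) ≤ 2 := by rw [hEn0]; nlinarith
  have hsq : ∀ s ∈ Icc 0 τ, ∀ i, X s i ^ 2 ≤ 2 := fun s hs i => traj_sq_le_two hX hE hEn2 (hI s hs) i
  have hθ1 : ε ^ 2 / K ^ 10 ≤ ε ^ 2 := div_le_self (sq_nonneg ε) (one_le_pow₀ (by linarith))
  -- Step 1: `c ≥ 0` (barrier with `L = 2M/ε`, using `b ≤ 2`)
  have hc : ∀ s ∈ Icc 0 τ, 0 ≤ X s 2 := by
    intro s hs
    refine nonneg_of_deriv_barrier (L := 2 * M * ε⁻¹) (a := 0) (b := τ) (by positivity)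
      (fun r hr => hasDerivAt_c (hX r (hI r hr))) (by rw [h02]) (fun r hr hcr => ?_) hs
    have hb2 : X r 1 ≤ 2 := by nlinarith [hsq r ⟨hr.1, hr.2.le⟩ 1]
    have h1 : 2 * M * ε⁻¹ * X r 2 ≤ ε⁻¹ * M * X r 1 * X r 2 := by
      have : 0 ≤ (2 - X r 1) * (-(X r 2)) := mul_nonneg (by linarith) (by linarith)
      have hεi : 0 ≤ ε⁻¹ * M := by positivity
      nlinarith [mul_nonneg hεi this]
    have h2 : 0 ≤ -(E r 2 * X r 2) := by
      rw [neg_nonneg]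
      exact mul_nonpos_of_nonneg_of_nonpos (hE r (hI r ⟨hr.1, hr.2.le⟩) 2).1 hcr.le
    have h3 : 0 ≤ ε ^ 2 * exp (-M) * X r 0 ^ 2 := by positivity
    linarith
  have hMc : ∀ r ∈ Icc 0 τ, ε⁻¹ * M * X r 2 ^ 2 ≤ ε := by
    intro r hr
    have hc2 : X r 2 ^ 2 ≤ (ε ^ 2) ^ 2 := pow_le_pow_left₀ (hc r hr) ((hcθ r hr).trans hθ1) 2
    calc ε⁻¹ * M * X r 2 ^ 2 ≤ ε⁻¹ * M * (ε ^ 2) ^ 2 := mul_le_mul_of_nonneg_left hc2 (by positivity)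
      _ = ε * (M * ε ^ 2) := by field_simp
      _ ≤ ε * 1 := mul_le_mul_of_nonneg_left hMε hε.le
      _ = ε := mul_one ε
  -- Step 2: lower barrier for the clock: `b ≥ β - (ε + β/4)t ≥ β/2`
  have hbl : ∀ s ∈ Icc 0 τ, β / 2 ≤ X s 1 := by
    intro s hs
    have hbar := nonneg_of_deriv_barrier (L := 0) (a := 0) (b := τ)
      (f := fun t => X t 1 + (ε + β / 4) * t - β)
      (f' := fun t => (ε * X t 0 ^ 2 - ε⁻¹ * M * X t 2 ^ 2 - E t 1 * X t 1) + (ε + β / 4) * 1)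
      le_rfl (fun r hr => ((hasDerivAt_b (hX r (hI r hr))).add
        ((hasDerivAt_id' (x := r)).const_mul (ε + β / 4))).sub_const β)
      (by simp [h01]) (fun r hr hfr => ?_) hs
    · have h : 0 ≤ X s 1 + (ε + β / 4) * s - β := hbar
      have : (ε + β / 4) * s ≤ (ε + β / 4) * 1 :=
        mul_le_mul_of_nonneg_left (hs.2.trans hτ1) (by positivity)
      linarith
    · -- at a point where `b < β - (ε + β/4) r ≤ β`: `ḃ + ε + β/4 ≥ -ε - E₁ b + ε + β/4 ≥ 0`
      have hbβ : X r 1 ≤ β := by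
        have : 0 ≤ (ε + β / 4) * r := by have := hr.1; positivity
        linarith
      have hE1 := hE r (hI r ⟨hr.1, hr.2.le⟩) 1
      have h1 : E r 1 * X r 1 ≤ β / 4 := by
        rcases le_or_gt 0 (X r 1) with hb | hb
        · calc E r 1 * X r 1 ≤ η * X r 1 := mul_le_mul_of_nonneg_right hE1.2 hb
            _ ≤ 1 / 4 * β := mul_le_mul hη hbβ hb (by norm_num)
            _ = β / 4 := by ring
        · have : E r 1 * X r 1 ≤ 0 := mul_nonpos_of_nonneg_of_nonpos hE1.1 hb.le
          linarith
      have h2 := hMc r ⟨hr.1, hr.2.le⟩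
      have h3 : 0 ≤ ε * X r 0 ^ 2 := by positivity
      rw [zero_mul]; linarith
  -- Step 3: `b ≤ β + 2εt` (uses `b ≥ 0`)
  have hD : ∀ r ∈ Icc 0 τ, ε * X r 0 ^ 2 - ε⁻¹ * M * X r 2 ^ 2 - E r 1 * X r 1 ≤ 2 * ε := by
    intro r hr
    have h1 : ε * X r 0 ^ 2 ≤ ε * 2 := mul_le_mul_of_nonneg_left (hsq r hr 0) hε.le
    have h2 : 0 ≤ ε⁻¹ * M * X r 2 ^ 2 := by have := hc r hr; positivity
    have h3 : 0 ≤ E r 1 * X r 1 := mul_nonneg (hE r (hI r hr) 1).1 (by linarith [hbl r hr])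
    linarith
  have hanti := antitoneOn_sub_of_deriv_le (f := fun s => X s 1)
    (f' := fun r => ε * X r 0 ^ 2 - ε⁻¹ * M * X r 2 ^ 2 - E r 1 * X r 1)
    (Φ := fun s => 2 * ε * s) (φ := fun _ => 2 * ε) (convex_Icc 0 τ)
    (fun r hr => hasDerivAt_b (hX r (hI r hr)))
    (fun r _ => by simpa using (hasDerivAt_id r).const_mul (2 * ε)) hD
  intro s hs
  have h := hanti ⟨le_rfl, hs.1.trans hs.2⟩ hs hs.1
  simp only [h01, mul_zero, sub_zero] at h
  exact ⟨hc s hs, hbl s hs, by linarith⟩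

/-- Bootstrap, II (the rotor stays off): under the hypotheses of `prefire_clock`, `d² + ã² ≤ 4K⁻¹⁰t` on `[0,τ]`.
[cite: Tao2016AveragedNS, §5.5 (5.5)] -/
theorem prefire_rotor
    (hX : ∀ t ∈ Icc (0:ℝ) 2, HasDerivAt X (delayCircuitWith K M ε (X t) - E t * X t) t)
    (hE : ∀ t ∈ Icc (0:ℝ) 2, ∀ i, 0 ≤ E t i ∧ E t i ≤ η) (hη : η ≤ 1 / 4)
    (h00 : X 0 0 = 1) (h01 : X 0 1 = β) (h02 : X 0 2 = 0) (h03 : X 0 3 = 0) (h04 : X 0 4 = 0)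
    (hβε : 10 * ε ≤ β) (hβ : β ≤ 1 / 10) (hε : 0 < ε) (hM1 : 1 ≤ M) (hMε : M * ε ^ 2 ≤ 1) (hK : 16 ≤ K)
    {τ : ℝ} (hτ1 : τ ≤ 1) (hcθ : ∀ t ∈ Icc 0 τ, X t 2 ≤ ε ^ 2 / K ^ 10) :
    ∀ s ∈ Icc 0 τ, X s 3 ^ 2 + X s 4 ^ 2 ≤ 4 / K ^ 10 * s := by
  have hI : ∀ s ∈ Icc 0 τ, s ∈ Icc (0:ℝ) 2 := fun s hs => ⟨hs.1, by linarith [hs.2]⟩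
  have hK0 : 0 < K := by linarith
  have hβ0 : 0 < β := by linarith
  have hEn0 : energy (X 0) = 1 + β ^ 2 := by
    simp only [energy, Fin.sum_univ_five, h00, h01, h02, h03, h04]; ring
  have hEn2 : energy (X 0) ≤ 2 := by rw [hEn0]; nlinarith
  have hsq : ∀ s ∈ Icc 0 τ, ∀ i, X s i ^ 2 ≤ 2 := fun s hs i => traj_sq_le_two hX hE hEn2 (hI s hs) i
  have hθ1 : ε ^ 2 / K ^ 10 ≤ ε ^ 2 := div_le_self (sq_nonneg ε) (one_le_pow₀ (by linarith))
  have hcl := prefire_clock hX hE hη h00 h01 h02 h03 h04 hβε hβ hε hM1 hMε hK hτ1 hcθ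
  have hD : ∀ r ∈ Icc 0 τ,
      ((ε ^ 2)⁻¹ * X r 2 * X r 0 - K * X r 3 * X r 4 - E r 3 * X r 3) * X r 3
        + X r 3 * ((ε ^ 2)⁻¹ * X r 2 * X r 0 - K * X r 3 * X r 4 - E r 3 * X r 3)
        + ((K * X r 3 ^ 2 - E r 4 * X r 4) * X r 4 + X r 4 * (K * X r 3 ^ 2 - E r 4 * X r 4))
        ≤ 4 / K ^ 10 := by
    intro r hr
    have had : X r 0 * X r 3 ≤ 2 := by nlinarith [sq_nonneg (X r 0 - X r 3), hsq r hr 0, hsq r hr 3]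
    have hc' : 0 ≤ (ε ^ 2)⁻¹ * X r 2 := mul_nonneg (by positivity) (hcl r hr).1
    have hcK : (ε ^ 2)⁻¹ * X r 2 ≤ 1 / K ^ 10 := by
      rw [inv_mul_le_iff₀ (by positivity)]
      calc X r 2 ≤ ε ^ 2 / K ^ 10 := hcθ r hr
        _ = ε ^ 2 * (1 / K ^ 10) := by ring
    have hkey : 2 * ((ε ^ 2)⁻¹ * X r 2 * (X r 0 * X r 3)) ≤ 4 / K ^ 10 :=
      calc 2 * ((ε ^ 2)⁻¹ * X r 2 * (X r 0 * X r 3)) ≤ 2 * ((ε ^ 2)⁻¹ * X r 2 * 2) :=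
            mul_le_mul_of_nonneg_left (mul_le_mul_of_nonneg_left had hc') (by norm_num)
        _ ≤ 2 * (1 / K ^ 10 * 2) :=
            mul_le_mul_of_nonneg_left (mul_le_mul_of_nonneg_right hcK (by norm_num)) (by norm_num)
        _ = 4 / K ^ 10 := by ring
    have hE3 : 0 ≤ E r 3 * X r 3 ^ 2 := mul_nonneg (hE r (hI r hr) 3).1 (sq_nonneg _)
    have hE4 : 0 ≤ E r 4 * X r 4 ^ 2 := mul_nonneg (hE r (hI r hr) 4).1 (sq_nonneg _)
    have hring : ((ε ^ 2)⁻¹ * X r 2 * X r 0 - K * X r 3 * X r 4 - E r 3 * X r 3) * X r 3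
        + X r 3 * ((ε ^ 2)⁻¹ * X r 2 * X r 0 - K * X r 3 * X r 4 - E r 3 * X r 3)
        + ((K * X r 3 ^ 2 - E r 4 * X r 4) * X r 4 + X r 4 * (K * X r 3 ^ 2 - E r 4 * X r 4))
        = 2 * ((ε ^ 2)⁻¹ * X r 2 * (X r 0 * X r 3)) - 2 * (E r 3 * X r 3 ^ 2)
          - 2 * (E r 4 * X r 4 ^ 2) := by ring
    rw [hring]; linarith
  have hanti := antitoneOn_sub_of_deriv_le (f := fun s => X s 3 * X s 3 + X s 4 * X s 4)
    (f' := fun r => ((ε ^ 2)⁻¹ * X r 2 * X r 0 - K * X r 3 * X r 4 - E r 3 * X r 3) * X r 3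
        + X r 3 * ((ε ^ 2)⁻¹ * X r 2 * X r 0 - K * X r 3 * X r 4 - E r 3 * X r 3)
        + ((K * X r 3 ^ 2 - E r 4 * X r 4) * X r 4 + X r 4 * (K * X r 3 ^ 2 - E r 4 * X r 4)))
    (Φ := fun s => 4 / K ^ 10 * s) (φ := fun _ => 4 / K ^ 10) (convex_Icc 0 τ)
    (fun r hr => ((hasDerivAt_d (hX r (hI r hr))).mul (hasDerivAt_d (hX r (hI r hr)))).add
      ((hasDerivAt_e (hX r (hI r hr))).mul (hasDerivAt_e (hX r (hI r hr)))))
    (fun r _ => by simpa using (hasDerivAt_id r).const_mul (4 / K ^ 10)) hD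
  intro s hs
  have h := hanti ⟨le_rfl, hs.1.trans hs.2⟩ hs hs.1
  simp only [h03, h04, mul_zero, add_zero, sub_zero] at h
  have : X s 3 ^ 2 + X s 4 ^ 2 = X s 3 * X s 3 + X s 4 * X s 4 := by ring
  rw [this]; linarith

/-- Bootstrap, III (the carrier survives): under the hypotheses of `prefire_clock`, `a² ≥ 2/5` on `[0,τ]`
(energy decays at most like `e^{-2ηt} ≥ 1/2`, and `b² + c² + d² + ã² ≤ 3/100`). [cite: Tao2016AveragedNS, §5.5] -/
theorem prefire_carrier
    (hX : ∀ t ∈ Icc (0:ℝ) 2, HasDerivAt X (delayCircuitWith K M ε (X t) - E t * X t) t)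
    (hE : ∀ t ∈ Icc (0:ℝ) 2, ∀ i, 0 ≤ E t i ∧ E t i ≤ η) (hη : η ≤ 1 / 4)
    (h00 : X 0 0 = 1) (h01 : X 0 1 = β) (h02 : X 0 2 = 0) (h03 : X 0 3 = 0) (h04 : X 0 4 = 0)
    (hβε : 10 * ε ≤ β) (hβ : β ≤ 1 / 10) (hε : 0 < ε) (hM1 : 1 ≤ M) (hMε : M * ε ^ 2 ≤ 1) (hK : 16 ≤ K)
    {τ : ℝ} (hτ1 : τ ≤ 1) (hcθ : ∀ t ∈ Icc 0 τ, X t 2 ≤ ε ^ 2 / K ^ 10) :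
    ∀ s ∈ Icc 0 τ, 2 / 5 ≤ X s 0 ^ 2 := by
  have hI : ∀ s ∈ Icc 0 τ, s ∈ Icc (0:ℝ) 2 := fun s hs => ⟨hs.1, by linarith [hs.2]⟩
  have hK0 : 0 < K := by linarith
  have hβ0 : 0 < β := by linarith
  have hEn0 : energy (X 0) = 1 + β ^ 2 := by
    simp only [energy, Fin.sum_univ_five, h00, h01, h02, h03, h04]; ring
  have hEn2 : energy (X 0) ≤ 2 := by rw [hEn0]; nlinarith
  have hsq : ∀ s ∈ Icc 0 τ, ∀ i, X s i ^ 2 ≤ 2 := fun s hs i => traj_sq_le_two hX hE hEn2 (hI s hs) i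
  have hθ1 : ε ^ 2 / K ^ 10 ≤ ε ^ 2 := div_le_self (sq_nonneg ε) (one_le_pow₀ (by linarith))
  have hcl := prefire_clock hX hE hη h00 h01 h02 h03 h04 hβε hβ hε hM1 hMε hK hτ1 hcθ
  have hS := prefire_rotor hX hE hη h00 h01 h02 h03 h04 hβε hβ hε hM1 hMε hK hτ1 hcθ
  have hη0 : 0 ≤ η := le_trans (hE 0 ⟨le_rfl, zero_le_two⟩ 0).1 (hE 0 ⟨le_rfl, zero_le_two⟩ 0).2
  intro s hs
  obtain ⟨hc, hbl, hbu⟩ := hcl s hs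
  have hmono := energy_mul_exp_monotoneOn_damped (isCancelling_delayCircuitWith K M ε)
    (convex_Icc 0 2) hX (fun t ht i => (hE t ht i).2) ⟨le_rfl, zero_le_two⟩ (hI s hs) hs.1
  simp only [mul_zero, exp_zero, mul_one] at hmono
  -- `energy(X s) ≥ energy(X 0) e^{-2ηs} ≥ 1 - 2ηs ≥ 1/2`
  have hexp : -(2 * η * s) + 1 ≤ exp (-(2 * η * s)) := add_one_le_exp _
  have hprod : exp (2 * η * s) * exp (-(2 * η * s)) = 1 := by rw [← exp_add]; simp
  have hEs : energy (X 0) * exp (-(2 * η * s)) ≤ energy (X s) :=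
    calc energy (X 0) * exp (-(2 * η * s)) ≤ energy (X s) * exp (2 * η * s) * exp (-(2 * η * s)) :=
          mul_le_mul_of_nonneg_right hmono (exp_pos _).le
      _ = energy (X s) * (exp (2 * η * s) * exp (-(2 * η * s))) := by ring
      _ = energy (X s) := by rw [hprod, mul_one]
  have hηs : 2 * η * s ≤ 1 / 2 := by
    have : 2 * η * s ≤ 2 * η * 1 := mul_le_mul_of_nonneg_left (hs.2.trans hτ1) (by positivity)
    linarith
  have hE0 : 1 ≤ energy (X 0) := by rw [hEn0]; nlinarith
  have hhalf : 1 / 2 ≤ energy (X s) := by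
    have h1 : 1 / 2 ≤ exp (-(2 * η * s)) := by linarith
    have h2 : 1 * (1 / 2) ≤ energy (X 0) * exp (-(2 * η * s)) :=
      mul_le_mul hE0 h1 (by norm_num) (by linarith)
    linarith
  have hsum : energy (X s) = X s 0 ^ 2 + X s 1 ^ 2 + X s 2 ^ 2 + X s 3 ^ 2 + X s 4 ^ 2 := by
    simp [energy, Fin.sum_univ_five]
  have hb1 : X s 1 ^ 2 ≤ 144 / 10000 := by
    have h2s : 2 * ε * s ≤ 2 * ε * 1 := mul_le_mul_of_nonneg_left (hs.2.trans hτ1) (by positivity)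
    have hb' : X s 1 ≤ 12 / 100 := by linarith
    have hb0 : 0 ≤ X s 1 := by linarith
    calc X s 1 ^ 2 = X s 1 * X s 1 := sq _
      _ ≤ X s 1 * (12 / 100) := mul_le_mul_of_nonneg_left hb' hb0
      _ ≤ 12 / 100 * (12 / 100) := mul_le_mul_of_nonneg_right hb' (by norm_num)
      _ = 144 / 10000 := by norm_num
  have hc1 : X s 2 ^ 2 ≤ 1 / 10000 := by
    have hε1 : ε ≤ 1 / 100 := by linarith
    have hε2 : ε ^ 2 ≤ 1 / 100 := by nlinarith
    have hcs : X s 2 ≤ 1 / 100 := by linarith [hcθ s hs, hθ1]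
    calc X s 2 ^ 2 = X s 2 * X s 2 := sq _
      _ ≤ X s 2 * (1 / 100) := mul_le_mul_of_nonneg_left hcs hc
      _ ≤ 1 / 100 * (1 / 100) := mul_le_mul_of_nonneg_right hcs (by norm_num)
      _ = 1 / 10000 := by norm_num
  have hS1 : X s 3 ^ 2 + X s 4 ^ 2 ≤ 1 / 100 := by
    have h4 : 4 / K ^ 10 * s ≤ 4 / K ^ 10 * 1 := mul_le_mul_of_nonneg_left (hs.2.trans hτ1) (by positivity)
    have hK10 : (16:ℝ) ^ 10 ≤ K ^ 10 := pow_le_pow_left₀ (by norm_num) hK 10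
    have h4' : 4 / K ^ 10 ≤ 1 / 100 := by
      rw [div_le_div_iff₀ (by positivity) (by norm_num)]; nlinarith
    linarith [hS s hs]
  linarith

/-- **The bootstrap up to the hitting time.** Under the hypotheses of `prefire_clock`, on `[0,τ]`:
`c ≥ (2/5)ε²e^{-M}t` (seed: `a² ≥ 2/5`, amplifier non-negative) and `t ↦ c(t)e^{-4Mt}` is non-decreasing
(amplifier `ε⁻¹Mb - E₂ ≥ 5M - 1/4 ≥ 4M`). [cite: Tao2016AveragedNS, §5.5 (5.5)] -/
theorem prefire_aux
    (hX : ∀ t ∈ Icc (0:ℝ) 2, HasDerivAt X (delayCircuitWith K M ε (X t) - E t * X t) t)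
    (hE : ∀ t ∈ Icc (0:ℝ) 2, ∀ i, 0 ≤ E t i ∧ E t i ≤ η) (hη : η ≤ 1 / 4)
    (h00 : X 0 0 = 1) (h01 : X 0 1 = β) (h02 : X 0 2 = 0) (h03 : X 0 3 = 0) (h04 : X 0 4 = 0)
    (hβε : 10 * ε ≤ β) (hβ : β ≤ 1 / 10) (hε : 0 < ε) (hM1 : 1 ≤ M) (hMε : M * ε ^ 2 ≤ 1) (hK : 16 ≤ K)
    {τ : ℝ} (hτ1 : τ ≤ 1) (hcθ : ∀ t ∈ Icc 0 τ, X t 2 ≤ ε ^ 2 / K ^ 10) :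
    (∀ t ∈ Icc 0 τ, 2 / 5 * ε ^ 2 * exp (-M) * t ≤ X t 2) ∧
      MonotoneOn (fun t => X t 2 * exp (-(4 * M * t)) - 0) (Icc 0 τ) := by
  have hI : ∀ s ∈ Icc 0 τ, s ∈ Icc (0:ℝ) 2 := fun s hs => ⟨hs.1, by linarith [hs.2]⟩
  have hcl := prefire_clock hX hE hη h00 h01 h02 h03 h04 hβε hβ hε hM1 hMε hK hτ1 hcθ
  have ha := prefire_carrier hX hE hη h00 h01 h02 h03 h04 hβε hβ hε hM1 hMε hK hτ1 hcθ
  -- the amplifier strength: `ε⁻¹ M b ≥ 5M`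
  have hamp : ∀ r ∈ Icc 0 τ, 5 * M ≤ ε⁻¹ * M * X r 1 := by
    intro r hr
    have h5 : 5 * ε ≤ X r 1 := by linarith [(hcl r hr).2.1]
    calc 5 * M = ε⁻¹ * M * (5 * ε) := by field_simp
      _ ≤ ε⁻¹ * M * X r 1 := mul_le_mul_of_nonneg_left h5 (by positivity)
  -- the seed: `c ≥ (2/5)ε²e^{-M} t`
  have hseed : ∀ s ∈ Icc 0 τ, 2 / 5 * ε ^ 2 * exp (-M) * s ≤ X s 2 := by
    have hD : ∀ r ∈ Icc 0 τ, 2 / 5 * ε ^ 2 * exp (-M)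
        ≤ ε ^ 2 * exp (-M) * X r 0 ^ 2 + ε⁻¹ * M * X r 1 * X r 2 - E r 2 * X r 2 := by
      intro r hr
      have h1 : ε ^ 2 * exp (-M) * (2 / 5) ≤ ε ^ 2 * exp (-M) * X r 0 ^ 2 :=
        mul_le_mul_of_nonneg_left (ha r hr) (by positivity)
      have hE2 := hE r (hI r hr) 2
      have h2 : 0 ≤ (ε⁻¹ * M * X r 1 - E r 2) * X r 2 :=
        mul_nonneg (by linarith [hamp r hr, hE2.2]) (hcl r hr).1
      have hring : ε⁻¹ * M * X r 1 * X r 2 - E r 2 * X r 2 = (ε⁻¹ * M * X r 1 - E r 2) * X r 2 := by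
        ring
      linarith
    have hmono := monotoneOn_sub_of_le_deriv (f := fun s => X s 2)
      (f' := fun r => ε ^ 2 * exp (-M) * X r 0 ^ 2 + ε⁻¹ * M * X r 1 * X r 2 - E r 2 * X r 2)
      (Φ := fun s => 2 / 5 * ε ^ 2 * exp (-M) * s) (φ := fun _ => 2 / 5 * ε ^ 2 * exp (-M))
      (convex_Icc 0 τ) (fun r hr => hasDerivAt_c (hX r (hI r hr)))
      (fun r _ => by simpa using (hasDerivAt_id r).const_mul (2 / 5 * ε ^ 2 * exp (-M))) hD
    intro s hs
    have h := hmono ⟨le_rfl, hs.1.trans hs.2⟩ hs hs.1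
    simp only [h02, mul_zero, sub_zero] at h
    linarith
  -- the amplifier: `c e^{-4Mt}` is non-decreasing
  have hmono := monotoneOn_intFactor (f := fun s => X s 2)
    (f' := fun r => ε ^ 2 * exp (-M) * X r 0 ^ 2 + ε⁻¹ * M * X r 1 * X r 2 - E r 2 * X r 2)
    (g := fun _ => 4 * M) (G := fun t => 4 * M * t) (φ := fun _ => 0) (Φ := fun _ => 0)
    (convex_Icc 0 τ) (fun r hr => hasDerivAt_c (hX r (hI r hr)))
    (fun r _ => by simpa using (hasDerivAt_id r).const_mul (4 * M))
    (fun r _ => hasDerivAt_const r 0) (fun r hr => ?_)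
  · exact ⟨hseed, hmono⟩
  · have hE2 := hE r (hI r hr) 2
    have h2 : 0 ≤ (ε⁻¹ * M * X r 1 - E r 2 - 4 * M) * X r 2 :=
      mul_nonneg (by linarith [hamp r hr, hE2.2]) (hcl r hr).1
    have h3 : 0 ≤ ε ^ 2 * exp (-M) * X r 0 ^ 2 := by positivity
    have hring : ε ^ 2 * exp (-M) * X r 0 ^ 2 + ε⁻¹ * M * X r 1 * X r 2 - E r 2 * X r 2
        - (fun _ : ℝ => 4 * M) r * X r 2
        = ε ^ 2 * exp (-M) * X r 0 ^ 2 + (ε⁻¹ * M * X r 1 - E r 2 - 4 * M) * X r 2 := by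
      simp only []; ring
    rw [hring]
    exact mul_nonneg (by linarith) (exp_pos _).le

/-- **PREMATURE FIRING ON A POSITIVE CLOCK PERTURBATION.** Input `(1, β, 0, 0, 0)` with `10ε ≤ β ≤ 1/10`, any damping
`0 ≤ Eᵢ ≤ η ≤ 1/4`, `M ≥ 1`, `Mε² ≤ 1`, `K ≥ 16`: the trigger reaches its critical level `ε²K⁻¹⁰` at some `t ≤ 1`
(from `delayInit` it does so only at `t_c > 1.39`, `firingPhase`). [cite: Tao2016AveragedNS, §5.5 (5.5), Theorem 5.3] -/
theorem prefire_of_positive_clock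
    (hX : ∀ t ∈ Icc (0:ℝ) 2, HasDerivAt X (delayCircuitWith K M ε (X t) - E t * X t) t)
    (hE : ∀ t ∈ Icc (0:ℝ) 2, ∀ i, 0 ≤ E t i ∧ E t i ≤ η) (hη : η ≤ 1 / 4)
    (h00 : X 0 0 = 1) (h01 : X 0 1 = β) (h02 : X 0 2 = 0) (h03 : X 0 3 = 0) (h04 : X 0 4 = 0)
    (hβε : 10 * ε ≤ β) (hβ : β ≤ 1 / 10) (hε : 0 < ε) (hM1 : 1 ≤ M) (hMε : M * ε ^ 2 ≤ 1) (hK : 16 ≤ K) :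
    ∃ t ∈ Icc (0:ℝ) 1, ε ^ 2 / K ^ 10 ≤ X t 2 := by
  have hK0 : 0 < K := by linarith
  have hθ0 : X 0 2 < ε ^ 2 / K ^ 10 := by rw [h02]; positivity
  obtain ⟨τ, hτ0, hτ1, hle, heq⟩ := exists_hitTime_on (θ := ε ^ 2 / K ^ 10) one_pos
    ((continuousOn_traj hX 2).mono (Icc_subset_Icc_right (by norm_num))) hθ0
  have hcθ : ∀ t ∈ Icc 0 τ, X t 2 ≤ ε ^ 2 / K ^ 10 := fun t ht => hle t ht.1 ht.2
  obtain ⟨hcl, hmono⟩ :=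
    prefire_aux hX hE hη h00 h01 h02 h03 h04 hβε hβ hε hM1 hMε hK hτ1 hcθ
  by_cases hlt : τ < 1
  · exact ⟨τ, ⟨hτ0.le, hτ1⟩, (heq hlt).symm.le⟩
  · have hτ : τ = 1 := le_antisymm hτ1 (not_lt.1 hlt)
    subst hτ
    refine ⟨1, ⟨zero_le_one, le_rfl⟩, ?_⟩
    have h12 : (1 / 2 : ℝ) ∈ Icc (0:ℝ) 1 := ⟨by norm_num, by norm_num⟩
    have hc12 : 1 / 5 * ε ^ 2 * exp (-M) ≤ X (1 / 2) 2 := by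
      have := hcl (1 / 2) h12; linarith
    have hm := hmono h12 ⟨zero_le_one, le_rfl⟩ (by norm_num : (1 / 2 : ℝ) ≤ 1)
    simp only [sub_zero, mul_one] at hm
    -- `c(1) e^{-4M} ≥ c(1/2) e^{-2M} ≥ (1/5)ε²e^{-3M}`, so `c(1) ≥ (1/5)ε²e^{M} ≥ ε²/5 ≥ ε²K⁻¹⁰`
    have h2M : exp (-(4 * M * (1 / 2))) = exp (-(2 * M)) := by ring_nf
    rw [h2M] at hm
    have hprod : exp (-(4 * M)) * exp (4 * M) = 1 := by rw [← exp_add]; simp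
    have hprod2 : exp (-(2 * M)) * exp (4 * M) = exp (2 * M) := by rw [← exp_add]; ring_nf
    have hc1 : X (1 / 2) 2 * exp (2 * M) ≤ X 1 2 := by
      have := mul_le_mul_of_nonneg_right hm (exp_pos (4 * M)).le
      rwa [mul_assoc, hprod2, mul_assoc, hprod, mul_one] at this
    have he3 : exp (-M) * exp (2 * M) = exp M := by rw [← exp_add]; ring_nf
    have hlow : 1 / 5 * ε ^ 2 * exp M ≤ X 1 2 := by
      have := mul_le_mul_of_nonneg_right hc12 (exp_pos (2 * M)).le
      rw [mul_assoc, he3] at this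
      exact this.trans hc1
    have heM : 1 ≤ exp M := one_le_exp (by linarith)
    have h5 : ε ^ 2 / K ^ 10 ≤ 1 / 5 * ε ^ 2 := by
      rw [div_le_iff₀ (by positivity)]
      have : (5:ℝ) ≤ K ^ 10 := by
        have := pow_le_pow_left₀ (by norm_num : (0:ℝ) ≤ 16) hK 10; nlinarith
      nlinarith [sq_nonneg ε]
    nlinarith [sq_nonneg ε]

/-- **PREMATURE FIRING UNDER THE FAMILY OF THE GATE THEOREM.** Same `K, M, ε` as `DampedTransition.firingPhase`, any
damping `0 ≤ Eᵢ ≤ η ≤ 1/4`, input `(1, β, 0, 0, 0)` with `10ε ≤ β ≤ 1/10`: the trigger is critical (`c ≥ ε²K⁻¹⁰`)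
at some `t ≤ 1 < 1.39 < t_c(delayInit)`. With part 9: an input clock off by `±10ε` either kills the gate on `[0,2]`
or fires it early — the clock must be exact to `O(ε)`. HONEST FRAMING: five-mode ODE; low prior, high
value-of-information experiment on Tao's machine paradigm; NOT a claim that NS blows up.
[cite: Tao2016AveragedNS, §5.5 Theorem 5.3; §6.1] -/
theorem prefire_family
    (hX : ∀ t ∈ Icc (0:ℝ) 2, HasDerivAt X (delayCircuitWith K M ε (X t) - E t * X t) t)
    (hE : ∀ t ∈ Icc (0:ℝ) 2, ∀ i, 0 ≤ E t i ∧ E t i ≤ η) (hη : η ≤ 1 / 4)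
    (h00 : X 0 0 = 1) (h01 : X 0 1 = β) (h02 : X 0 2 = 0) (h03 : X 0 3 = 0) (h04 : X 0 4 = 0)
    (hβε : 10 * ε ≤ β) (hβ : β ≤ 1 / 10)
    (hK : 2 * 20 ^ 42 * (Nat.factorial 42 : ℝ) + 16 ≤ K) (hML : 3000 * Real.log K ≤ M)
    (hMK : M ≤ K ^ 10) (hε : 0 < ε) (hεle : ε ≤ exp (-(10 * M)) / K ^ 100) :
    ∃ t ∈ Icc (0:ℝ) 1, ε ^ 2 / K ^ 10 ≤ X t 2 := by
  obtain ⟨hK16, hM0, -, hlog2, -⟩ := family_params hK hML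
  obtain ⟨-, hεK, -, -⟩ := eps_facts hK16 hM0 hMK hε hεle
  have hK0 : 0 < K := by linarith
  have hM1 : 1 ≤ M := by linarith
  have hMε : M * ε ^ 2 ≤ 1 := by
    have h1 : M * ε ^ 2 ≤ K ^ 10 * (1 / (6 * K ^ 20)) :=
      mul_le_mul hMK hεK (sq_nonneg ε) (by positivity)
    have h2 : K ^ 10 * (1 / (6 * K ^ 20)) ≤ 1 := by
      rw [mul_one_div, div_le_one (by positivity)]
      have : (1:ℝ) ≤ K ^ 10 := one_le_pow₀ (by linarith)
      nlinarith [pow_pos hK0 10]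
    linarith
  exact prefire_of_positive_clock hX hE hη h00 h01 h02 h03 h04 hβε hβ hε hM1 hMε hK16

end Prefire

end DampedTransition

end Summit.NavierStokesRegularity.FluidComputer
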